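import Summits.QuantumAdvantage.QuantumAdvantage.Theorems.CubicForrelationNearExactIsExactTwelveBoundary
import Summits.QuantumAdvantage.QuantumAdvantage.Theorems.CubicForrelationNearExactIsExactFourModSixSecondBoundary
import Summits.QuantumAdvantage.QuantumAdvantage.Theorems.CubicForrelationNearExactIsExactTenThetaExact

/-!
# Crux `CubicForrelation.NearExactIsExact` (stmt-QuantumAdvantage-14043) — the SECOND dyadic boundary is never attained:
  for every `n ≥ 12` with `n ≢ 2 (mod 6)`, `Φ ≥ 1 − 2^{−⌊n/3⌋} ⇒ Φ = 1`

Certificate seat `b2b-cforr-cert` (gen 8).  HONEST FRAMING: one uniform statement packaging this generation's theorems — infinitely many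
finite-slice verdicts; NOT summit progress (the constants tend to `1`; the crux asks for ONE `θ < 1`).

`isolation_closed_second_boundary`: for every `n ≥ 12` with `n ≡ 0` or `4 (mod 6)` and all cubic `f, g : 𝔽₂ⁿ → 𝔽₂`,
`Φ(f,g) ≥ 1 − 2^{−⌊n/3⌋} ⇒ Φ(f,g) = 1`; equivalently `θ_n < 1 − 2^{−⌊n/3⌋}` (`theta_lt_second_boundary`).  Assembled from
`isolation_twelve_closed` (`n = 12`, this generation), `isolation_sixteen_closed` (`n = 16`, gen 6), `isolation_closed_zero_mod_six_sharp`
(`n ≡ 0`, `n ≥ 18`) and `isolation_closed_four_mod_six_sharp` (`n ≡ 4`, `n ≥ 22`).  This halves the gap left by the uniform rate theorem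
`isolation_rate_closed_all` (`1 − 2^{−⌊n/3⌋−1}`, gen 6) on two of the three residue classes.  It is SHARP in `n` in the sense that at `n = 10`
the value `1 − 2^{−⌊n/3⌋} = 7/8` IS attained (`theta_ten_isLeast`); for `n ≡ 2 (mod 6)` (`n = 14, 20, 26, …`) only the rate is known — there
the type-O digit `d₁` is quadratic and the two-sided budget is not exhausted by Reed–Muller weights (see the gen-8 write-up).

Certified ladder after this file: `θ₆ < 7/8`, `θ₈ = 13/16`, `θ₁₀ = 7/8`, `θ₁₂ ∈ [57/64, 15/16)`, `θ₁₄ ∈ [57/64, 31/32)`, `θ₁₆ ∈ [15/16, 31/32)`,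
`θ₁₈ ∈ [15/16, 63/64)`, `θ₂₀ ∈ [15/16, 127/128)`, `θ₂₂ ∈ [15/16, 127/128)`, `θ₂₄ ∈ [15/16, 255/256)`, …; uniformly
`θ_n < 1 − 2^{−⌊n/3⌋−1}` for all even `n ≥ 6` and `θ_n < 1 − 2^{−⌊n/3⌋}` for all `n ≥ 12` with `n ≢ 2 (mod 6)`.

References: as in the imported files.  Everything below is proved from the tree; axioms are the standard three.
-/

set_option linter.dupNamespace false -- D-0017: single-problem summit ⇒ `QuantumAdvantage.QuantumAdvantage` by design

noncomputable section

namespace Summit.QuantumAdvantage.QuantumAdvantage.Theorems.CubicForrelation.NearExactIsExact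

open Finset
open Literature.Computability.QuantumComplexity

/-- **The second dyadic boundary is never attained (`n ≥ 12`, `n ≢ 2 (mod 6)`).** For every `n ≥ 12` with `n ≡ 0` or `n ≡ 4 (mod 6)` and
all cubic `f, g : 𝔽₂ⁿ → 𝔽₂: `Φ(f,g) ≥ 1 − 2^{−⌊n/3⌋} ⇒ Φ(f,g) = 1`.  Infinitely many finite-slice verdicts; NOT summit progress. [this work] -/
theorem isolation_closed_second_boundary : ∀ n : ℕ, (n % 6 = 0 ∨ n % 6 = 4) → 12 ≤ n → ∀ f g : (Fin n → Bool) → Bool,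
    IsDegLeFun 3 f → IsDegLeFun 3 g → 1 - (1 / 2 : ℝ) ^ (n / 3) ≤ forrelation f g → forrelation f g = 1 := by
  intro n hn h12 f g hf hg hΦ
  by_cases h12' : n = 12
  · subst h12'
    exact isolation_twelve_closed f g hf hg (by norm_num at hΦ; exact hΦ)
  · exact isolation_closed_sharp_zero_or_four_mod_six n hn (by omega) f g hf hg hΦ

/-- **`θ_n < 1 − 2^{−⌊n/3⌋}` for every `n ≥ 12` with `n ≡ 0` or `4 (mod 6)`.** NOT summit progress. [this work] -/
theorem theta_lt_second_boundary (n : ℕ) (hn : n % 6 = 0 ∨ n % 6 = 4) (h12 : 12 ≤ n) :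
    ∃ θ : ℝ, θ < 1 - (1 / 2 : ℝ) ^ (n / 3) ∧ ∀ f g : (Fin n → Bool) → Bool, IsDegLeFun 3 f → IsDegLeFun 3 g →
      θ < forrelation f g → forrelation f g = 1 :=
  fb_theta_lt_of_closed (n := n) _ (isolation_closed_second_boundary n hn h12)

/-- **Sharpness at `n = 10`:** there the value `1 − 2^{−⌊10/3⌋} = 7/8` IS attained by a non-exact cubic pair (`theta_ten_isLeast`), so the
hypothesis `n ≥ 12` in `isolation_closed_second_boundary` cannot be lowered to `10`. [this work] -/
theorem second_boundary_attained_ten : ∃ f g : (Fin 10 → Bool) → Bool, IsDegLeFun 3 f ∧ IsDegLeFun 3 g ∧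
    forrelation f g = 1 - (1 / 2 : ℝ) ^ (10 / 3) ∧ forrelation f g < 1 := by
  obtain ⟨f, g, hf, hg, hval, hlt⟩ := forrelation_values_ten_isGreatest.1
  exact ⟨f, g, hf, hg, by rw [hval]; norm_num, by rw [hval]; norm_num⟩

end Summit.QuantumAdvantage.QuantumAdvantage.Theorems.CubicForrelation.NearExactIsExact

end
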